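import Literature.AlgebraicGeometry.ComplexMultiplication.CMBalancedWeightSplitting
import Literature.AlgebraicGeometry.Pohlmann1968.DivisorClassesCMAlgebra
import Literature.AlgebraicGeometry.HodgeTheory.WeilClassesIsogenyDescent
import Literature.AlgebraicGeometry.HodgeTheory.AbelianVarietyPullbackAlgebraicClasses
import Literature.AlgebraicGeometry.HodgeTheory.AbelianLowDimensionWeilReductionProofs
import Literature.AlgebraicGeometry.HodgeTheory.LefschetzOneOneHolds
import Literature.AlgebraicGeometry.HodgeTheory.HodgeConjectureIsogenyInvariance
import Literature.AlgebraicGeometry.Motives.AbelianVarietyProduct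
import HarnessLib

/-!
# Weights of a product of CM abelian varieties: conjugation-stable weights are divisor weights, constant-eigenvalue
# weights are Weil eigenclasses, and the Weil plane of `⨁_{j<2} A_j` versus `A₀ × A₁`

COR-CM (cell `pub-hodgecm2`), seat b30 gen 14 (2026-08-21); count-neutral helper file of
`CorCM/DihedralSexticPairHodgeOfMarkman.lean` (the Hodge conjecture for the product `B₀ × B₁` of two Galois-conjugate
simple CM threefolds of a non-Galois sextic CM field, modulo Markman).  Three general dictionary entries between
Pohlmann's weights on `B = ⨁_j A_j` (the tree's `Pohlmann1968.weightClassesAlg`, CM algebra `∏_j K_j`) and the two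
halves `D• + W_K` of a divisor–Weil generated Hodge ring:

* §1 `mem_pohlmannDivisorSetsAlg_of_conj_smul_mem` — a weight `S ⊆ ⊔_j Hom(K_j, ℂ)` of size `2m` STABLE UNDER COMPLEX
  CONJUGATION is a disjoint union of `m` conjugate pairs `{x, x̄}`, each balanced (`CMWeights.isGaloisBalancedAlg_pair_conj`),
  hence a Pohlmann divisor set; so `H^{2m}(B)_S ⊆ Dᵐ(B) ⊗ ℂ ⊆ Nᵐ H^{2m}(B)` (`divisorClassesSpan_biproduct_eq_iSup`,
  Lefschetz `(1,1)` + cup products on an abelian variety) [cite: Gordon1999HodgeAVSurvey, 9.2.2]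
  [cite: vanGeemen1994HodgeAV, §2.4];
* §2 `weightClassesAlg_le_weilClassesPlus` / `…Minus` — if every point `(j, s)` of `S` has the SAME eigenvalue
  `s(a_j) = ± i√d` for a family `a ∈ ∏_j 𝓞_{K_j}`, then `H^{|S|}(B)_S` lies in the `±`-Weil eigenclasses of
  `(B, φ)`, `φ = ⊕_j ι_j(a_j)`: the test endomorphisms `x·𝟙 + y·φ = ⊕_j ι_j(x + y a_j)` act on `H_S` by
  `∏_{(j,s) ∈ S} (x + y s(a_j)) = (x ± y i√d)^{|S|}` [cite: vanGeemen1994HodgeAV, 4.9 and proof of Thm. 6.12]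
  [cite: Milne2020HodgeClassesAV, 1.2 (a)];
* §3 `weilClassesOf_biproduct_le_algebraicClasses_of_prod` — for two factors, the algebraicity of the Weil plane of
  `(A₀ × A₁, f₀ × f₁)` (the tree's `AbelianVariety.prod`, the shape of `CorCM/CMThreefoldPairWeilClassesOfMarkman.lean`)
  gives that of `(⨁_{j<2} A_j, ⊕_j f_j)` along the canonical isomorphism (`map_mem_weilClassesOf_of_comm`,
  `map_mem_algebraicClasses_of_abelianVariety`); and `hodgeConjectureFor_prod_of_biproduct` transports the Hodge conjecture
  back [cite: vanGeemen1994HodgeAV, 3.6–3.7].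

Theorems only, no definition, no named fact, no `sorry`.

## References
* [Gordon1999HodgeAVSurvey] B. B. Gordon, CRM Monogr. 10 (1999), §9.2, 9.2.2.
* [vanGeemen1994HodgeAV] B. van Geemen, LNM 1594 (1994), §2.4, 3.6–3.7, 4.9, proof of Thm. 6.12.
* [Milne2020HodgeClassesAV] J. S. Milne, arXiv:2010.08857, 1.2 (a).
* [GaoUllmo2025] Z. Gao, E. Ullmo, J. Inst. Math. Jussieu 25 (2025), Thm. 3.1.

Provenance: Literature home (namespace `Literature.AlgebraicGeometry.ComplexMultiplication.PairWeights`) of the Summits-side `CorCM/DihedralSexticPairWeights` (cell `pub-hodgecm2`, COR-CM; all its imports are `Literature/`, Mathlib and the already re-homed `CMBalancedWeightSplitting`), which `Literature/` may not import; theorems only, no named fact, no definition. Nothing here bears on `HC_CM`. Lane `lit-hodgefound` (Layer A3: CM types, their Kubota ranks and Galois combinatorics), seat p20.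
-/

noncomputable section

open _root_.CategoryTheory _root_.CategoryTheory.Limits NumberField

namespace Literature.AlgebraicGeometry.ComplexMultiplication.PairWeights

open Literature.AlgebraicGeometry.ComplexMultiplication.CMWeights

open Literature.AlgebraicGeometry Literature.AlgebraicGeometry.Motives Literature.AlgebraicGeometry.HodgeTheory
open Literature.AlgebraicGeometry.ComplexMultiplication (IsCMTypeRealisation)
open Literature.AlgebraicGeometry.Pohlmann1968
open Literature.AlgebraicTopology.SingularHomology
open Literature.Barriers.HodgeConjecture (divisorClassesSpan)
open Literature.NumberTheory.ComplexMultiplication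
open Literature.AlgebraicGeometry.ComplexMultiplication.CMWeights

open scoped Classical Pointwise

/-! ## §1 Conjugation-stable weights are Pohlmann divisor sets -/

section ConjStable

variable {n : ℕ} {K : Fin n → Type} [∀ i, Field (K i)] [∀ i, NumberField (K i)] [∀ i, IsCMField (K i)]

/-- **A conjugation-stable weight of size `2m` is a disjoint union of `m` conjugate pairs**, hence a Pohlmann divisor
set (each pair `{x, x̄}` is balanced: `CMWeights.isGaloisBalancedAlg_pair_conj`). Induction on `m`, peeling off one
pair `{x, x̄} ⊆ S`. [cite: Gordon1999HodgeAVSurvey, 9.2.2] -/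
theorem mem_pohlmannDivisorSetsAlg_of_conj_smul_mem (Φ : ∀ i, CMType (K i)) :
    ∀ (m : ℕ) {S : Finset ((i : Fin n) × (K i →+* ℂ))}, S.card = 2 * m →
      (∀ x ∈ S, (starRingAut : ℂ ≃+* ℂ) • x ∈ S) → S ∈ pohlmannDivisorSetsAlg Φ m
  | 0, S, hcard, _ => by
    rw [pohlmannDivisorSetsAlg_def, mem_disjointUnionsOf_zero]
    exact Finset.card_eq_zero.1 hcard
  | m + 1, S, hcard, hconj => by
    obtain ⟨x, hx⟩ : S.Nonempty := by rw [← Finset.card_pos, hcard]; omega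
    set t : Finset ((i : Fin n) × (K i →+* ℂ)) := {x} ∪ (starRingAut : ℂ ≃+* ℂ) • ({x} : Finset _) with ht_def
    have ht1 : t ∈ pohlmannSetsAlg Φ 1 := by
      refine ⟨?_, isGaloisBalancedAlg_pair_conj Φ x⟩
      rw [ht_def, Finset.card_union_of_disjoint (disjoint_singleton_conj_smul Φ x), Finset.card_singleton,
        Finset.card_smul_finset, Finset.card_singleton]
    have hmem_t : ∀ y, y ∈ t ↔ y = x ∨ y = (starRingAut : ℂ ≃+* ℂ) • x := fun y => by
      rw [ht_def, Finset.smul_finset_singleton, Finset.mem_union, Finset.mem_singleton, Finset.mem_singleton]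
    have htS : t ⊆ S := fun y hy => by
      rcases (hmem_t y).1 hy with rfl | rfl
      · exact hx
      · exact hconj _ hx
    have hdisj : Disjoint (S \ t) t := Finset.sdiff_disjoint
    have hSeq : S = (S \ t).disjUnion t hdisj := by
      rw [Finset.disjUnion_eq_union, Finset.sdiff_union_of_subset htS]
    have hcard' : (S \ t).card = 2 * m := by
      rw [Finset.card_sdiff_of_subset htS, hcard, ht1.1]; omega
    have hconj' : ∀ y ∈ S \ t, (starRingAut : ℂ ≃+* ℂ) • y ∈ S \ t := by
      intro y hy
      rw [Finset.mem_sdiff] at hy ⊢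
      refine ⟨hconj y hy.1, fun hyt => hy.2 ?_⟩
      rw [hmem_t] at hyt ⊢
      rcases hyt with h | h
      · exact Or.inr (by rw [← h, conj_smul_conj_smul])
      · exact Or.inl (MulAction.injective (starRingAut : ℂ ≃+* ℂ) h)
    rw [hSeq, pohlmannDivisorSetsAlg_def, mem_disjointUnionsOf_succ]
    exact ⟨S \ t, (pohlmannDivisorSetsAlg_def Φ m) ▸
      mem_pohlmannDivisorSetsAlg_of_conj_smul_mem Φ m hcard' hconj', t, ht1, hdisj, rfl⟩

variable {A : Fin n → AbelianVariety ℂ} {Φ : ∀ i, CMType (K i)} {ι : ∀ i, 𝓞 (K i) →+* End (A i)}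
  {θ : ∀ i, K i →+* Module.End ℂ (complexBetti (A i).X 1)}

/-- **`H^{2m}(B)_S ⊆ Dᵐ(B) ⊗ ℂ` for a conjugation-stable weight `S` of size `2m`** on a product `B = ⨁_j A_j` of
realisations of CM types. [cite: Gordon1999HodgeAVSurvey, 9.2.2] [cite: vanGeemen1994HodgeAV, §2.4] -/
theorem weightClassesAlg_le_divisorClassesSpan_of_conj_smul_mem
    (hA : ∀ i, IsCMTypeRealisation (Φ i) (A i) (ι i) (θ i)) {m : ℕ} {S : Finset ((i : Fin n) × (K i →+* ℂ))}
    (hcard : S.card = 2 * m) (hconj : ∀ x ∈ S, (starRingAut : ℂ ≃+* ℂ) • x ∈ S) :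
    weightClassesAlg A ι (2 * m) S ≤ divisorClassesSpan (⨁ A).X (⨁ A).dim m := by
  rw [divisorClassesSpan_biproduct_eq_iSup hA m]
  exact le_iSup₂_of_le S (mem_pohlmannDivisorSetsAlg_of_conj_smul_mem Φ m hcard hconj) le_rfl

/-- **`H^{2m}(B)_S` consists of algebraic classes for a conjugation-stable weight `S`**: divisor monomials are
algebraic on an abelian variety (Lefschetz `(1,1)`, the tree's `lefschetzOneOne_rational_holds`, and cup products,
`AbelianVariety.divisorClassesSpan_le_algebraicClasses`). [cite: vanGeemen1994HodgeAV, §2.4] -/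
theorem weightClassesAlg_le_algebraicClasses_of_conj_smul_mem
    (hA : ∀ i, IsCMTypeRealisation (Φ i) (A i) (ι i) (θ i)) {m : ℕ} {S : Finset ((i : Fin n) × (K i →+* ℂ))}
    (hcard : S.card = 2 * m) (hconj : ∀ x ∈ S, (starRingAut : ℂ ≃+* ℂ) • x ∈ S) :
    weightClassesAlg A ι (2 * m) S ≤ algebraicClasses (⨁ A).X m :=
  (weightClassesAlg_le_divisorClassesSpan_of_conj_smul_mem hA hcard hconj).trans
    (AbelianVariety.divisorClassesSpan_le_algebraicClasses (⨁ A)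
      (fun b hb hb' => lefschetzOneOne_rational_holds
        (Motives.AbelianVariety.isSmoothProjective_holds (A := ⨁ A)) b hb hb') m)

end ConjStable

/-! ## §2 Constant-eigenvalue weights are Weil eigenclasses of `φ = ⊕_j ι_j(a_j)` -/

section Eigen

variable {n : ℕ} {K : Fin n → Type} [∀ i, Field (K i)]
  {A : Fin n → AbelianVariety ℂ} {ι : ∀ i, 𝓞 (K i) →+* End (A i)}

/-- `ι_j(x + y·a) = x·1 + y·ι_j(a)` in the ring `End(A_j)` (`ι_j` is a ring homomorphism). [cite: Gordon1999HodgeAVSurvey, 9.2.2] -/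
theorem map_natCast_add_natCast_mul (j : Fin n) (a : 𝓞 (K j)) (x y : ℕ) :
    ι j ((x : 𝓞 (K j)) + (y : 𝓞 (K j)) * a) = x • (1 : End (A j)) + y • ι j a := by
  rw [map_add, map_mul, map_natCast, map_natCast, ← nsmul_eq_mul, ← Nat.smul_one_eq_cast]

/-- **The test endomorphisms of `(⨁ A, ⊕_j ι_j(a_j))` are diagonal**: `x·𝟙 + y·(⊕_j ι_j(a_j)) = ⊕_j ι_j(x + y a_j)`.
 [cite: Gordon1999HodgeAVSurvey, 9.2.2] -/
theorem nsmul_id_add_nsmul_biproduct_map (a : ∀ j, 𝓞 (K j)) (x y : ℕ) :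
    x • 𝟙 (⨁ A) + y • biproduct.map (fun j => ι j (a j)) =
      biproduct.map fun j => ι j ((x : 𝓞 (K j)) + (y : 𝓞 (K j)) * a j) := by
  refine biproduct.hom_ext _ _ fun j => ?_
  rw [Preadditive.add_comp, Preadditive.nsmul_comp, Preadditive.nsmul_comp, Category.id_comp, biproduct.map_π,
    biproduct.map_π, map_natCast_add_natCast_mul]
  change x • biproduct.π A j + y • (biproduct.π A j ≫ ι j (a j)) =
    biproduct.π A j ≫ (x • 𝟙 (A j) + y • (show A j ⟶ A j from ι j (a j)))
  rw [Preadditive.comp_add, Preadditive.comp_nsmul, Preadditive.comp_nsmul, Category.comp_id]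

/-- **A weight all of whose points have the same eigenvalue `μ` on the family `a` lies in the `χ`-eigenclasses of
`φ = ⊕_j ι_j(a_j)` for `χ(x, y) = (x + y μ)^{|S|}`**: on `H_S` the diagonal endomorphism `⊕_j ι_j(x + y a_j)` acts by
`∏_{(j,s) ∈ S} s(x + y a_j) = (x + y μ)^{|S|}`. [cite: Milne2020HodgeClassesAV, 1.2 (a)] [cite: vanGeemen1994HodgeAV, 4.9] -/
theorem weightClassesAlg_le_pullbackEigenclasses (a : ∀ j, 𝓞 (K j)) {k : ℕ}
    {S : Finset ((i : Fin n) × (K i →+* ℂ))} {μ : ℂ} (hS : ∀ z ∈ S, z.2 ((a z.1 : 𝓞 (K z.1)) : K z.1) = μ) :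
    weightClassesAlg A ι k S ≤
      pullbackEigenclasses (⨁ A) (biproduct.map fun j => ι j (a j)) k fun x y => ((x : ℂ) + (y : ℂ) * μ) ^ S.card := by
  intro c hc
  rw [mem_pullbackEigenclasses_iff]
  intro x y
  have h := (mem_weightClassesAlg_iff.1 hc) fun j => (x : 𝓞 (K j)) + (y : 𝓞 (K j)) * a j
  rw [← nsmul_id_add_nsmul_biproduct_map a x y] at h
  have hprod : (∏ z ∈ S, z.2 ((((x : 𝓞 (K z.1)) + (y : 𝓞 (K z.1)) * a z.1 : 𝓞 (K z.1)) : K z.1))) =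
      ((x : ℂ) + (y : ℂ) * μ) ^ S.card := by
    rw [← Finset.prod_const]
    refine Finset.prod_congr rfl fun z hz => ?_
    rw [← hS z hz]
    push_cast
    rw [map_add, map_mul, map_natCast, map_natCast]
  rw [hprod] at h
  exact h

/-- **Constant eigenvalue `+i√d` ⟹ `H_S ⊆ E₊(⨁ A, ⊕_j ι_j(a_j))`** (`|S| = 2n'`). [cite: vanGeemen1994HodgeAV, 4.9 and proof of Thm. 6.12] -/
theorem weightClassesAlg_le_weilClassesPlus (a : ∀ j, 𝓞 (K j)) {n' d : ℕ}
    {S : Finset ((i : Fin n) × (K i →+* ℂ))} (hcard : S.card = 2 * n')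
    (hS : ∀ z ∈ S, z.2 ((a z.1 : 𝓞 (K z.1)) : K z.1) = Complex.I * (Real.sqrt d : ℂ)) :
    weightClassesAlg A ι (2 * n') S ≤ weilClassesPlus (⨁ A) (biproduct.map fun j => ι j (a j)) n' d := by
  intro c hc
  rw [mem_weilClassesPlus_iff]
  intro x y
  have h := (mem_pullbackEigenclasses_iff.1 (weightClassesAlg_le_pullbackEigenclasses a hS hc)) x y
  rw [hcard] at h
  rw [h, mul_assoc]

/-- **Constant eigenvalue `-i√d` ⟹ `H_S ⊆ E₋(⨁ A, ⊕_j ι_j(a_j))`** (`|S| = 2n'`). [cite: vanGeemen1994HodgeAV, 4.9 and proof of Thm. 6.12] -/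
theorem weightClassesAlg_le_weilClassesMinus (a : ∀ j, 𝓞 (K j)) {n' d : ℕ}
    {S : Finset ((i : Fin n) × (K i →+* ℂ))} (hcard : S.card = 2 * n')
    (hS : ∀ z ∈ S, z.2 ((a z.1 : 𝓞 (K z.1)) : K z.1) = -(Complex.I * (Real.sqrt d : ℂ))) :
    weightClassesAlg A ι (2 * n') S ≤ weilClassesMinus (⨁ A) (biproduct.map fun j => ι j (a j)) n' d := by
  intro c hc
  rw [mem_weilClassesMinus_iff]
  intro x y
  have h := (mem_pullbackEigenclasses_iff.1 (weightClassesAlg_le_pullbackEigenclasses a hS hc)) x y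
  rw [hcard] at h
  rw [h, mul_neg, ← sub_eq_add_neg, mul_assoc]

end Eigen

/-! ## §3 Two factors: `⨁_{j<2} A_j` versus `A₀ × A₁` -/

section TwoFactors

variable {A : Fin 2 → AbelianVariety ℂ}

/-- The homomorphism `A₀ × A₁ ⟶ ⨁_{j<2} A_j` with components `(fst, snd)`. [cite: Gordon1999HodgeAVSurvey, 9.2.2] -/
theorem biproduct_lift_fst_snd_π_zero :
    biproduct.lift (Fin.cons (AbelianVariety.fst (A 0) (A 1))
        (Fin.cons (AbelianVariety.snd (A 0) (A 1)) finZeroElim) : ∀ j, (A 0).prod (A 1) ⟶ A j) ≫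
      biproduct.π A 0 = AbelianVariety.fst (A 0) (A 1) := by
  rw [biproduct.lift_π]; rfl

/-- The second component of `(fst, snd) : A₀ × A₁ ⟶ ⨁_{j<2} A_j`. [cite: Gordon1999HodgeAVSurvey, 9.2.2] -/
theorem biproduct_lift_fst_snd_π_one :
    biproduct.lift (Fin.cons (AbelianVariety.fst (A 0) (A 1))
        (Fin.cons (AbelianVariety.snd (A 0) (A 1)) finZeroElim) : ∀ j, (A 0).prod (A 1) ⟶ A j) ≫
      biproduct.π A 1 = AbelianVariety.snd (A 0) (A 1) := by
  rw [biproduct.lift_π]; rfl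

/-- `(π₀, π₁) ≫ (fst, snd) = 𝟙` on `⨁_{j<2} A_j`. [cite: Gordon1999HodgeAVSurvey, 9.2.2] -/
theorem prodLift_π_comp_biproduct_lift :
    AbelianVariety.prodLift (biproduct.π A 0) (biproduct.π A 1) ≫
      biproduct.lift (Fin.cons (AbelianVariety.fst (A 0) (A 1))
        (Fin.cons (AbelianVariety.snd (A 0) (A 1)) finZeroElim) : ∀ j, (A 0).prod (A 1) ⟶ A j) = 𝟙 (⨁ A) := by
  refine biproduct.hom_ext _ _ fun j => ?_
  rw [Category.assoc, Category.id_comp]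
  refine Fin.cases ?_ (fun i => Fin.cases ?_ (fun l => l.elim0) i) j
  · rw [biproduct_lift_fst_snd_π_zero, AbelianVariety.prodLift_fst]
  · change _ ≫ _ ≫ biproduct.π A 1 = biproduct.π A 1
    rw [biproduct_lift_fst_snd_π_one, AbelianVariety.prodLift_snd]

/-- **Equivariance**: `(fst, snd)` intertwines `f₀ × f₁` on `A₀ × A₁` and `⊕_j f_j` on `⨁_{j<2} A_j`. [cite: Gordon1999HodgeAVSurvey, 9.2.2] -/
theorem biproduct_lift_comp_map (f : ∀ j, A j ⟶ A j) :
    biproduct.lift (Fin.cons (AbelianVariety.fst (A 0) (A 1))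
        (Fin.cons (AbelianVariety.snd (A 0) (A 1)) finZeroElim) : ∀ j, (A 0).prod (A 1) ⟶ A j) ≫
      biproduct.map f =
    AbelianVariety.prodLift (AbelianVariety.fst (A 0) (A 1) ≫ f 0) (AbelianVariety.snd (A 0) (A 1) ≫ f 1) ≫
      biproduct.lift (Fin.cons (AbelianVariety.fst (A 0) (A 1))
        (Fin.cons (AbelianVariety.snd (A 0) (A 1)) finZeroElim) : ∀ j, (A 0).prod (A 1) ⟶ A j) := by
  refine biproduct.hom_ext _ _ fun j => ?_
  rw [Category.assoc, biproduct.map_π, Category.assoc]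
  refine Fin.cases ?_ (fun i => Fin.cases ?_ (fun l => l.elim0) i) j
  · rw [← Category.assoc, biproduct_lift_fst_snd_π_zero, AbelianVariety.prodLift_fst]
  · change _ ≫ biproduct.π A 1 ≫ f 1 = _ ≫ _ ≫ biproduct.π A 1
    rw [← Category.assoc, biproduct_lift_fst_snd_π_one, AbelianVariety.prodLift_snd]

/-- **The Weil plane of `(⨁_{j<2} A_j, ⊕_j f_j)` is algebraic if that of `(A₀ × A₁, f₀ × f₁)` is**: pull back along
the equivariant isomorphism `g = (fst, snd)` (`map_mem_weilClassesOf_of_comm`), use the hypothesis on `A₀ × A₁`,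
and pull back along `(π₀, π₁)` (`map_mem_algebraicClasses_of_abelianVariety`; `(π₀, π₁) ≫ g = 𝟙`).
[cite: vanGeemen1994HodgeAV, 3.6–3.7 and proof of Lemma 5.2] -/
theorem weilClassesOf_biproduct_le_algebraicClasses_of_prod (f : ∀ j, A j ⟶ A j) {n d : ℕ}
    (h : weilClassesOf ((A 0).prod (A 1))
        (AbelianVariety.prodLift (AbelianVariety.fst (A 0) (A 1) ≫ f 0) (AbelianVariety.snd (A 0) (A 1) ≫ f 1))
        n d ≤ algebraicClasses ((A 0).prod (A 1)).X n) :
    weilClassesOf (⨁ A) (biproduct.map f) n d ≤ algebraicClasses (⨁ A).X n := by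
  intro c hc
  set g : (A 0).prod (A 1) ⟶ ⨁ A := biproduct.lift (Fin.cons (AbelianVariety.fst (A 0) (A 1))
    (Fin.cons (AbelianVariety.snd (A 0) (A 1)) finZeroElim) : ∀ j, (A 0).prod (A 1) ⟶ A j) with hg_def
  have hg := map_mem_weilClassesOf_of_comm (n := n) (d := d) (biproduct_lift_comp_map f) hc
  have halg := h hg
  have h2 := map_mem_algebraicClasses_of_abelianVariety
    (Motives.AbelianVariety.isSmoothProjective_holds (A := ⨁ A)) ((A 0).prod (A 1))
    (AbelianVariety.prodLift (biproduct.π A 0) (biproduct.π A 1)).hom.hom.hom halg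
  have key : complexBetti.map (AbelianVariety.prodLift (biproduct.π A 0) (biproduct.π A 1)).hom.hom.hom (2 * n)
      (singularCohomology.map ℂ ℂ (Motives.AlgPoints.mapContinuous (L := ℂ) g.hom.hom.hom) (2 * n) c) = c := by
    change singularCohomology.map ℂ ℂ (Motives.AlgPoints.mapContinuous (L := ℂ)
      (AbelianVariety.prodLift (biproduct.π A 0) (biproduct.π A 1)).hom.hom.hom) (2 * n) _ = c
    rw [abelianVarietyHom_map_map_apply, hg_def, prodLift_π_comp_biproduct_lift]
    exact abelianVariety_map_id_apply c
  rw [key] at h2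
  exact h2

/-- **The Hodge conjecture for `A₀ × A₁` from that for `⨁_{j<2} A_j`** (isomorphic, in particular isogenous, abelian
varieties: van Geemen's Lemma 3.7, the tree's `HodgeConjectureFor.of_isIsogenous`). [cite: vanGeemen1994HodgeAV, 3.6–3.7] -/
theorem hodgeConjectureFor_prod_of_biproduct (h : HodgeConjectureFor (⨁ A).dim (⨁ A).X) :
    HodgeConjectureFor ((A 0).prod (A 1)).dim ((A 0).prod (A 1)).X := by
  refine HodgeConjectureFor.of_isIsogenous ⟨_, AbelianVariety.isIsogeny_hom_of_iso
    { hom := biproduct.lift (Fin.cons (AbelianVariety.fst (A 0) (A 1))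
        (Fin.cons (AbelianVariety.snd (A 0) (A 1)) finZeroElim) : ∀ j, (A 0).prod (A 1) ⟶ A j)
      inv := AbelianVariety.prodLift (biproduct.π A 0) (biproduct.π A 1)
      hom_inv_id := ?_
      inv_hom_id := prodLift_π_comp_biproduct_lift }⟩ h
  refine AbelianVariety.prod_hom_ext ?_ ?_
  · rw [Category.assoc, AbelianVariety.prodLift_fst, biproduct_lift_fst_snd_π_zero, Category.id_comp]
  · rw [Category.assoc, AbelianVariety.prodLift_snd, biproduct_lift_fst_snd_π_one, Category.id_comp]

end TwoFactors

end Literature.AlgebraicGeometry.ComplexMultiplication.PairWeights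

end
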